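import Summits.PneNP.PneNP.Theses.PhaseTwins
import Literature.Computability.Complexity.HardcoreInapproximability
import Literature.ModelTheory.FiniteModelTheory.CkEquivHomCount
import Literature.ModelTheory.FiniteModelTheory.CkEquivTransfer
import Literature.ModelTheory.FiniteModelTheory.XorLocalConsistency
import Literature.ModelTheory.FiniteModelTheory.SparseOrData

/-!
# Line `phase-lattice-gas` for crux `PhaseTwins.MacroscopicTwinsAbove` (stmt-PneNP-2720)

Skeleton (crux-plan, planner-cruxplan-stmt-PneNP-2720-phase-lattice-gas-0, 2026-08-16) of the crux idea
`phase-lattice-gas` (crux-ideate r1, ideator 2; triage r1-1/2/3: pass), with the three triage sharpenings built in: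
(i) the only genuinely new finite lemma — the weighted-independent-set ("lattice gas") energy gap — is its own stub
(`stub_latticeGasGap`), gadget-free and `λ`-explicit; (ii) the `(GpropA)` phase cost `N log n₁` is in the budget
(`stub_parameters`, `(1±δ₁)^{4m}` / `n₁^{4m}` factors carried exactly, no `o(1)`); (iii) the Duplicator step is a
pebble-GAME transfer on the wired graphs themselves (`stub_duplicator`, an instance of the tree's PROVED
`ckEquiv_of_consistencyFamily`), no coloured Dvořák converse is used.

THE LINE. Fix `Δ ≥ 3`, `λ > λ_c(Δ)`. ONE fixed Sly phase gadget `(G, W±, V±)` of size `n₁ = n₁(Δ, λ)`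
(`stub_slyGadgets` = Sly 2010 Thm 2.1 derandomised = the named fact `slyGadgetReduction`; `(GpropB)` gives ports that
are `(1±δ₁)`-product-Bernoulli given the PHASE `Y ∈ {±}`, with `0 < q⁻ < q⁺ < 1` on `V⁺`). SOURCE (`stub_source`, all
ingredients PROVED in the tree: `Xor3Gap.exists_threeUniformExpander` + `SparseOrData` degree splitting +
`SparseOrData.exists_far`): for every radius `s₀` a 3-XOR template `var : Fin m → Fin 3 → Fin n` with occurrence
indices `idx : Fin m → Fin 3 → Fin D` (`(var, idx)` injective, `D = 48`), `(s₀, 1/2)`-boundary expansion and a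
right-hand side `b` that EVERY assignment violates on `≥ m/16` equations. ENCODING (gauge-covariant, ONE vertex type for
both twins): the FGLSS graph of the template — vertices `(u, t₁, t₂)`, `t₃ := b_u + t₁ + t₂`, cliques `K₄` per
equation, the twin is `b = 0` (satisfiable, planted set `t = 0`). WIRING (`wGraph`): every FGLSS vertex is a COPY of
the gadget; a clique edge `{t, t'}` (colour = the position where `t, t'` agree) becomes `s` ONE-SIDED port edges
`V⁺(slot(p,j)) — V⁺(slot(p,j))` (repulsion `s·log slyB` between two `+` phases, Sly's `B > 1`); every vertex of
equation `u` gets `tU u` PENDANT LEAVES on `V⁻` ports (chemical potential `ψ₁ = log((1+λ(1−q⁻))/(1+λ(1−q⁺))) > 0` per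
leaf for the phase `+`); and the variable-consistency constraints of FGLSS — which come in gauge orbits of size 2,
`{(u,t) : t_p = c}` — are realised by `r` TWO-LEAF CONNECTORS per pair of occurrences `(x,i) < (x,i')` and class
`c`: `ℓ₀ ~ V⁺`-ports of the two vertices of class `(i, c)`, `ℓ₁ ~` those of class `(i', c+1)`, `ℓ₀ ~ ℓ₁` (degrees 3,
so `Δ = 3` works; the card's "leaf port absorbing the size-2 orbit"). Given the phases the extra structure has an
EXPLICIT product-measure weight `wW b Y` (`stub_transducer` = Sly's Lemma 2.2 for this wiring, shape of the PROVED
`cutProb_bounds_of_slyPropB`, valid for EVERY number of copies): a LATTICE GAS on the phase vector with nearest-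
neighbour repulsion on clique edges, a 4-body connector term that is submodular ACROSS the two sides (repulsion
`u_K > 0` by AM–GM) and supermodular WITHIN a side (attraction `a_K > 0` on a clique edge, dominated by the clique
repulsion), and per-vertex fields `φ_u = tU u·ψ₁ − 3s·h_P − cK u·r·h_K` equalised to within `ψ₁` by the leaf counts
`tU u = t₀ + ⌈cK u·r·h_K/ψ₁⌉` (`cK u` = number of connectors at a vertex of `u`). ENERGY GAP (`stub_latticeGasGap`,
finite): a charging argument (delete one vertex per violated clique edge / connector; each deletion costs `≤ μ_max ≤`
the penalty removed) bounds `log wW_b(Y) − log wW(∅)` by the field-weighted number of equations satisfied by ONE total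
assignment, while the planted configuration of the `b = 0` twin collects all `m` fields: gap `≥ μ_min · e`,
`e ≥ m/16`. DUPLICATOR (`stub_duplicator`): the gauge flip `(u,t) ↦ (u, t + f|_u)`, `(x,…,c,…) ↦ (x,…,c+f x,…)` × `id`
on gadget coordinates is a local flip action, adjacency reads `b` only at position-3 connector attachments, and
`XorSystem.Good` from boundary expansion is a consistency family ⇒ `wGraph b ≡_{C^k} wGraph 0` for `12k ≤ s₀`.
PARAMETERS (`stub_parameters`): `s, r, t₀, tL, n₁, δ` depend on `(Δ, λ)` ONLY; per `k` only the template grows —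
`δ` is uniform in `k`, as the crux demands (Disproof.lean `lt_card_of_witness`, `swapped_of_constantFactorTwins`).
The composition `MacroscopicTwinsAbove_of` (kernel-checked, no `sorry` of its own) transports to `Fin N`
(`CkEquiv.iso_congr`) and converts `≡_{C^{k+1}}` into the typed hom-count clause by the PROVED Dvořák bridge.

Stubs (7): `stub_slyGadgets` (XL, trust base = `slyGadgetReduction`, shared verbatim with the sibling line
`parity-wired-ports` of crux 2719; NOT a lead target), `stub_source` (M, provable now from tree lemmas),
`stub_maxDegree` (S–M), `stub_duplicator` (M), `stub_transducer` (L, hardest provable-now), `stub_latticeGasGap` (M–L,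
the new finite content), `stub_parameters` (M, asymptotic arithmetic incl. positivity of `ψ₁, h_P, h_K, u_K, a_K`).

Disproof.lean (cdisprove cycles 1–2) honoured: `false_without_threshold_of_densityContinuityBelow` — `λ > λ_c` enters
only through `stub_slyGadgets` (`q⁺ ≠ q⁻`; at `q⁺ = q⁻` every field/repulsion here vanishes); `false_without_degreeFloor`
— `3 ≤ Δ` is used for the connector vertices (degree 3) and `d ≤ Δ`; `defect_bound` / `delta_le_of_blocks` — the twins
differ at the position-3 attachments of `Θ(m)` connectors (`b` far from `Im ∂`: `≥ m/16` non-gaugeable violated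
equations under every assignment); `lt_card_of_witness` / `not_singlePair` — a fresh template per `k`, `δ` fixed first;
`swapped_of_constantFactorTwins` — not used: `δ = δ(Δ, λ)`; cycle 2: `not_uniformDelta`/`lamC_le_div` honoured (`δ`
depends on `(Δ, λ)` through `n₁, s, r, t₀, q±` and degenerates as `λ ↓ λ_c`, where every lattice-gas constant vanishes;
no uniformity in `(Δ, λ)` is claimed), `crux_iff_withoutDegH` noted (both degree bounds are certified anyway). Landed
`Theorems/MacroscopicTwinsAbove/Negative/DefectBound` was read (its import is omitted only because the farm reports the
module unbuilt); no stub is an instance it refutes: bare CFI / one Tseitin charge are not used, defects are `Θ(n)`.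
-/

noncomputable section

open scoped Classical BigOperators

namespace Summit.PneNP.PneNP.Cruxes.MacroscopicTwinsAbove.PhaseLatticeGas

open Finset
open Literature.Computability.Complexity (hardcoreZOn slyPhase SlyPropA SlyPropB slyB slyM
  slyGadgetReduction one_lt_slyB sum_hardcoreZOn_fiber hardcoreZOn_nonneg
  hardcoreZOn_le_independencePolynomial)
open Literature.ModelTheory.FiniteModelTheory (CkEquiv)
open Literature.Probability.LatticeModels (independencePolynomial hardCoreThreshold hardCoreThreshold_pos
  independencePolynomial_pos)
open Literature.Combinatorics.SimpleGraph (treewidth)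
open Summit.PneNP.PneNP.Theses.PhaseTwins (MacroscopicTwinsAbove)

set_option linter.unusedVariables false
set_option linter.dupNamespace false

/-! ## The construction -/

/-- FGLSS vertices of a template with `m` equations: `(u, t₁, t₂)`, the local assignment of equation `u` with
third value `t₃ := b_u + t₁ + t₂` (so both twins live on ONE vertex type). -/
abbrev BV (m : ℕ) : Type := Fin m × ZMod 2 × ZMod 2

/-- A 3-XOR TEMPLATE with occurrence indices: equation `u` reads `x_{var u 0} + x_{var u 1} + x_{var u 2} = b u`,
and `idx u p` is the local index of the occurrence `(u, p)` among the occurrences of its variable (used to address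
connector slots; `(var, idx)` is injective for the sources of `stub_source`). -/
structure Template (n m D : ℕ) where
  var : Fin m → Fin 3 → Fin n
  idx : Fin m → Fin 3 → Fin D

namespace Template

variable {n m D : ℕ} (T : Template n m D)

/-- The scope of equation `u` as a finite set (for `XorSystem.boundary` / `XorSystem.Good`). -/
def scope (u : Fin m) : Finset (Fin n) := Finset.univ.image (T.var u)

/-- `(x, i)` is an occurrence: some `(u, p)` has variable `x` and index `i`. -/
def Occ (x : Fin n) (i : Fin D) : Prop := ∃ (u : Fin m) (p : Fin 3), T.var u p = x ∧ T.idx u p = i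

/-- The connector between the occurrences `(x, i)` and `(x, i')` is WIRED: `i < i'` and both are occurrences. -/
def Wired (x : Fin n) (i i' : Fin D) : Prop := i < i' ∧ T.Occ x i ∧ T.Occ x i'

/-- `(var, idx)` is injective on `Fin m × Fin 3`. -/
def InjIdx : Prop := Function.Injective fun q : Fin m × Fin 3 => (T.var q.1 q.2, T.idx q.1 q.2)

/-- Three distinct variables per equation. -/
def WellFormed : Prop := ∀ u : Fin m, Function.Injective (T.var u)

/-- The number of wired connectors containing a vertex of equation `u`:
`cK u = Σ_p #{i' ≠ idx u p : (var u p, i') is an occurrence}` (at most `3D`). -/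
def cK (u : Fin m) : ℕ :=
  ∑ p : Fin 3, (Finset.univ.filter fun i' : Fin D => i' ≠ T.idx u p ∧ T.Occ (T.var u p) i').card

/-- `b` is `e`-FAR: every total assignment violates at least `e` equations. -/
def Far (b : Fin m → ZMod 2) (e : ℕ) : Prop :=
  ∀ g : Fin n → ZMod 2, e ≤ (Finset.univ.filter fun u : Fin m => g (T.var u 0) + g (T.var u 1) + g (T.var u 2) ≠ b u).card

/-- `(s₀, 1/2)`-boundary (unique-neighbour) expansion of the scopes. -/
def Expands (s₀ : ℕ) : Prop :=
  ∀ S : Finset (Fin m), S.card ≤ s₀ →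
    S.card ≤ 2 * (Literature.ModelTheory.FiniteModelTheory.XorSystem.boundary T.scope S).card

/-- `cK u ≤ 3 D`. -/
theorem cK_le (u : Fin m) : T.cK u ≤ 3 * D := by
  unfold cK
  calc ∑ p : Fin 3, (Finset.univ.filter fun i' : Fin D => i' ≠ T.idx u p ∧ T.Occ (T.var u p) i').card
      ≤ ∑ _p : Fin 3, D := Finset.sum_le_sum fun p _ =>
          (Finset.card_filter_le _ _).trans (by rw [Finset.card_univ, Fintype.card_fin])
    _ = 3 * D := by rw [Finset.sum_const, Finset.card_univ, Fintype.card_fin, smul_eq_mul]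

end Template

variable {n m v mP s r tL D : ℕ}

/-- The value of the local assignment `w = (u, t₁, t₂)` at position `p` (third value `b u + t₁ + t₂`). -/
def val (b : Fin m → ZMod 2) (w : BV m) (p : Fin 3) : ZMod 2 := ![w.2.1, w.2.2, b w.1 + w.2.1 + w.2.2] p

/-- Two distinct local assignments of one equation AGREE at exactly one position `p` — the COLOUR of the clique edge
`{t, t'}` (independent of `b`). -/
def cliqueCol (t t' : ZMod 2 × ZMod 2) (p : Fin 3) : Prop :=
  ![t.1 = t'.1, t.2 = t'.2, t.1 + t.2 = t'.1 + t'.2] p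

/-- The two endpoints (`i = 0, 1`) of the clique edge of colour `p` and class `c`. -/
def endpt (p : Fin 3) (c i : ZMod 2) : ZMod 2 × ZMod 2 := ![(c, i), (i, c), (i, c + i)] p

/-- A gadget with its wiring data: Sly's `(G, W⁺, W⁻, V⁺, V⁻)` on `Fin v` with `mP` ports of each sign, an injective
`V⁺`-SLOT map (`3s` clique slots `(p, j)` and `3Dr` connector slots `(p, i', j)`) and a `V⁻`-slot map for `tL`
leaves. -/
structure Wiring (v mP s r tL D : ℕ) where
  G : SimpleGraph (Fin v)
  Wp : Finset (Fin v)
  Wm : Finset (Fin v)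
  Vp : Fin mP ↪ Fin v
  Vm : Fin mP ↪ Fin v
  slot : (Fin 3 × Fin s) ⊕ (Fin 3 × Fin D × Fin r) ↪ Fin mP
  slotL : Fin tL ↪ Fin mP

/-- A `V⁺`-slot assignment from a cardinality bound. -/
def slotEmb {X : Type} [Fintype X] (h : Fintype.card X ≤ mP) : X ↪ Fin mP :=
  (Fintype.equivFin X).toEmbedding.trans (Fin.castLEEmb h)

/-- Connector vertices: `(x, i, i', c, j, e)` — variable, the two occurrence indices, the class, the copy `j < r`,
and which of the two leaves `ℓ₀, ℓ₁` (`e`). Only `i < i'` with both occurrences present is wired. -/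
abbrev CV (n D r : ℕ) : Type := Fin n × Fin D × Fin D × ZMod 2 × Fin r × ZMod 2

/-- The uniform vertex type of the wired graph: COPY vertices `((u,t), a)`, LEAF vertices `((u,t), j)`,
CONNECTOR vertices. -/
abbrev WV (n m v tL D r : ℕ) : Type := (BV m × Fin v) ⊕ (BV m × Fin tL) ⊕ CV n D r

/-- Generating adjacency of the wired graph `wGraph T W tU b` (symmetrised by `SimpleGraph.fromRel`):
(copy–copy) the gadget inside each copy, and the clique bundles: `s` port edges `V⁺(slot(p,j)) — V⁺(slot(p,j))`
between the two local assignments of one equation agreeing at position `p`; (leaf–copy) leaf `j < tU u` of `(u,t)`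
hangs on `V⁻(slotL j)`; (connector–copy) `ℓ₀` of the wired connector `(x,i,i',c,j)` is adjacent to the port
`V⁺(slot(p,i',j))` of the copies `(u,t)` with `(var u p, idx u p) = (x,i)` and `val_p = c`, `ℓ₁` to the port
`V⁺(slot(p,i,j))` of the copies with `(var, idx) = (x,i')` and `val_p = c+1`; (connector–connector) `ℓ₀ ~ ℓ₁`. -/
def wRel (T : Template n m D) (W : Wiring v mP s r tL D) (tU : Fin m → ℕ) (b : Fin m → ZMod 2) :
    WV n m v tL D r → WV n m v tL D r → Prop
  | .inl (w, a), .inl (w', a') =>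
      (w = w' ∧ W.G.Adj a a') ∨
      (w.1 = w'.1 ∧ w.2 ≠ w'.2 ∧ ∃ (p : Fin 3) (j : Fin s), cliqueCol w.2 w'.2 p ∧
        a = W.Vp (W.slot (Sum.inl (p, j))) ∧ a' = W.Vp (W.slot (Sum.inl (p, j))))
  | .inr (.inl (w, j)), .inl (w', a) => w = w' ∧ (j : ℕ) < tU w.1 ∧ a = W.Vm (W.slotL j)
  | .inr (.inr (x, i, i', c, j, e)), .inl (w, a) =>
      T.Wired x i i' ∧
        ((e = 0 ∧ ∃ p : Fin 3, T.var w.1 p = x ∧ T.idx w.1 p = i ∧ val b w p = c ∧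
            a = W.Vp (W.slot (Sum.inr (p, i', j)))) ∨
         (e = 1 ∧ ∃ p : Fin 3, T.var w.1 p = x ∧ T.idx w.1 p = i' ∧ val b w p = c + 1 ∧
            a = W.Vp (W.slot (Sum.inr (p, i, j)))))
  | .inr (.inr (x, i, i', c, j, e)), .inr (.inr (x', i₁, i₁', c', j', e')) =>
      x = x' ∧ i = i₁ ∧ i' = i₁' ∧ c = c' ∧ j = j' ∧ e ≠ e'
  | _, _ => False

/-- **The wired graph** of the template `T`, the gadget/wiring `W`, leaf counts `tU` and right-hand side `b`. -/
def wGraph (T : Template n m D) (W : Wiring v mP s r tL D) (tU : Fin m → ℕ) (b : Fin m → ZMod 2) :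
    SimpleGraph (WV n m v tL D r) :=
  SimpleGraph.fromRel (wRel T W tU b)

/-- Generating adjacency of the BASE graph: the `4m` disjoint gadget copies and the bare connector edges `ℓ₀ ~ ℓ₁`
(leaves isolated) — Sly's `Ĥ^G` for this wiring. -/
def wBaseRel (W : Wiring v mP s r tL D) : WV n m v tL D r → WV n m v tL D r → Prop
  | .inl (w, a), .inl (w', a') => w = w' ∧ W.G.Adj a a'
  | .inr (.inr (x, i, i', c, j, e)), .inr (.inr (x', i₁, i₁', c', j', e')) =>
      x = x' ∧ i = i₁ ∧ i' = i₁' ∧ c = c' ∧ j = j' ∧ e ≠ e'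
  | _, _ => False

/-- The base graph (copies + bare connector edges). -/
def wBase (n m : ℕ) (W : Wiring v mP s r tL D) : SimpleGraph (WV n m v tL D r) :=
  SimpleGraph.fromRel (wBaseRel (n := n) (m := m) W)

/-- The configuration on the copy `w`: its fibre. -/
def copyFib (I : Finset (WV n m v tL D r)) (w : BV m) : Finset (Fin v) :=
  univ.filter fun a => (Sum.inl (w, a) : WV n m v tL D r) ∈ I

/-- The PHASE VECTOR of a configuration: Sly's phase (`slyPhase`) of its restriction to every copy. -/
def wPhase (W : Wiring v mP s r tL D) (I : Finset (WV n m v tL D r)) : BV m → Bool :=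
  fun w => slyPhase W.Wp W.Wm (copyFib I w)

/-! ## The explicit weights (product-measure values of the extra structure, given the phases) -/

/-- Occupation probability of a `V⁺` port in phase `s` (`true` = `+`): `q⁺` resp. `q⁻`. -/
def pP (qp qm : ℝ) (s : Bool) : ℝ := if s then qp else qm

/-- Occupation probability of a `V⁻` port in phase `s`: `q⁻` resp. `q⁺`. -/
def pM (qp qm : ℝ) (s : Bool) : ℝ := if s then qm else qp

/-- The clique-bundle factor: for each equation `u`, colour `p` and class `c`, `s` port edges between the two
endpoints, each forbidding double occupation: `(1 − q(Y_t) q(Y_{t'}))^s`. -/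
def pairW (qp qm : ℝ) (s : ℕ) (Y : BV m → Bool) : ℝ :=
  ∏ u : Fin m, ∏ p : Fin 3, ∏ c : ZMod 2,
    (1 - pP qp qm (Y (u, endpt p c 0)) * pP qp qm (Y (u, endpt p c 1))) ^ s

/-- The leaf factor: `tU u` pendant leaves on `V⁻` ports of every vertex of equation `u`, each
`(1 + λ(1 − q̄(Y)))/(1 + λ)` relative to an isolated vertex. -/
def leafW (lam qp qm : ℝ) (tU : Fin m → ℕ) (Y : BV m → Bool) : ℝ :=
  ∏ w : BV m, ((1 + lam * (1 - pM qp qm (Y w))) / (1 + lam)) ^ tU w.1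

/-- The vacancy product of the side `(x, i, c)`: the (two) vertices with an occurrence `(x, i)` at a position where
their value is `c`. -/
def sideVac (T : Template n m D) (b : Fin m → ZMod 2) (qp qm : ℝ) (Y : BV m → Bool) (x : Fin n) (i : Fin D)
    (c : ZMod 2) : ℝ :=
  ∏ w ∈ (univ.filter fun w : BV m => ∃ p : Fin 3, T.var w.1 p = x ∧ T.idx w.1 p = i ∧ val b w p = c),
    (1 - pP qp qm (Y w))

/-- The connector factor: for each wired `(x, i, i', c)`, `r` two-leaf connectors, each
`(1 + λ·vac(side (i,c)) + λ·vac(side (i',c+1)))/(1 + 2λ)` relative to a bare edge. -/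
def connW (T : Template n m D) (b : Fin m → ZMod 2) (lam qp qm : ℝ) (r : ℕ) (Y : BV m → Bool) : ℝ :=
  ∏ x : Fin n, ∏ i : Fin D, ∏ i' : Fin D, ∏ c : ZMod 2,
    (if T.Wired x i i' then
      (1 + lam * sideVac T b qp qm Y x i c + lam * sideVac T b qp qm Y x i' (c + 1)) / (1 + 2 * lam)
     else 1) ^ r

/-- **The weight of a phase vector**: the expectation, under Sly's product measures `Q^{Y}` on the ports, of the
weight of the extra structure (clique bundles, leaves, connectors) relative to the base graph. -/
def wW (T : Template n m D) (b : Fin m → ZMod 2) (lam qp qm : ℝ) (s r : ℕ) (tU : Fin m → ℕ)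
    (Y : BV m → Bool) : ℝ :=
  pairW qp qm s Y * leafW lam qp qm tU Y * connW T b lam qp qm r Y

/-! ## The explicit constants of the effective lattice gas -/

/-- Leaf field `ψ₁ = log((1 + λ(1−q⁻))/(1 + λ(1−q⁺))) > 0`: the gain of the phase `+` per pendant `V⁻`-leaf. -/
def psi1 (lam qp qm : ℝ) : ℝ := Real.log ((1 + lam * (1 - qm)) / (1 + lam * (1 - qp)))

/-- Clique-edge field `h_P = log((1 − q⁻q⁻)/(1 − q⁺q⁻)) > 0`: the cost per port edge of one `+` endpoint. -/
def hP (qp qm : ℝ) : ℝ := Real.log ((1 - qm * qm) / (1 - qp * qm))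

/-- `F(S) = log(1 + λ S)`. -/
def Fl (lam S : ℝ) : ℝ := Real.log (1 + lam * S)

/-- Side vacancies: `X₀ = (1−q⁻)²` (no `+` on the side), `X₁ = (1−q⁺)(1−q⁻)` (one `+`), `X₂ = (1−q⁺)²` (two). -/
def X0 (qp qm : ℝ) : ℝ := (1 - qm) * (1 - qm)
def X1 (qp qm : ℝ) : ℝ := (1 - qp) * (1 - qm)
def X2 (qp qm : ℝ) : ℝ := (1 - qp) * (1 - qp)

/-- Connector field `h_K = F(2X₀) − F(X₁+X₀) > 0` per connector membership of a `+` vertex. -/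
def hK (lam qp qm : ℝ) : ℝ := Fl lam (2 * X0 qp qm) - Fl lam (X1 qp qm + X0 qp qm)

/-- Connector repulsion across the two sides `u_K = 2F(X₁+X₀) − F(2X₁) − F(2X₀) > 0` (AM–GM, strict iff `q⁺ ≠ q⁻`). -/
def uK (lam qp qm : ℝ) : ℝ := 2 * Fl lam (X1 qp qm + X0 qp qm) - Fl lam (2 * X1 qp qm) - Fl lam (2 * X0 qp qm)

/-- Connector attraction within a side `a_K = F(X₂+X₀) + F(2X₀) − 2F(X₁+X₀) > 0` (lands on a clique edge). -/
def aK (lam qp qm : ℝ) : ℝ := Fl lam (X2 qp qm + X0 qp qm) + Fl lam (2 * X0 qp qm) - 2 * Fl lam (X1 qp qm + X0 qp qm)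

/-! ## The stubs -/

/-- **S1 — Sly's phase gadgets = Sly 2010 Theorem 2.1, derandomised (GŠV16 Lemma 19; GGŠVY Lemma 5 / Cor. 6 for
the degree covering).** Literally the hypothesis `h21` of the tree's `slyGadgetReduction_of_gadgets`, hence
EQUIVALENT to the named fact `slyGadgetReduction`; stated VERBATIM as in the sibling line `parity-wired-ports`
(crux 2719) so that the two lines share one trust base. For `Δ ≥ 3`, `λ > λ_c(Δ)`: `d ∈ [3, Δ]` with `λ > λ_c(d)`,
`θ ∈ (0,1/8)`, `0 < q⁻ < q⁺ < 1` and, for all large `n`, a gadget on `≤ 3n` vertices of maximum degree `≤ d` with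
`2m` distinct ports of degree `≤ d-1` (`m = slyM d θ n`) satisfying `(GpropA)` at `n` and `(GpropB)` with
`δ = n^{-2θ}`. Only SOME `0 < q⁻ < q⁺ < 1` is needed below: every field/repulsion of the lattice gas is an explicit
function of `(λ, q±)` that is positive iff `q⁺ ≠ q⁻`. Size XL (vendored-fact strength; NOT a lead-prover target: the
line closes stmt-PneNP-2720 unconditionally exactly when this is discharged). -/
theorem stub_slyGadgets : ∀ Δ : ℕ, 3 ≤ Δ → ∀ lam : ℝ, hardCoreThreshold Δ < lam →
    ∃ d : ℕ, 3 ≤ d ∧ d ≤ Δ ∧ hardCoreThreshold d < lam ∧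
    ∃ θ qp qm : ℝ, 0 < θ ∧ θ < 1 / 8 ∧ 0 < qm ∧ qm < qp ∧ qp < 1 ∧
      ∃ n₁ : ℕ, ∀ n : ℕ, n₁ ≤ n →
        ∃ (v : ℕ) (G : SimpleGraph (Fin v)) (Wp Wm : Finset (Fin v))
          (Vp Vm : Fin (slyM d θ n) ↪ Fin v),
          (v : ℝ) ≤ 3 * n ∧ G.maxDegree ≤ d ∧ Disjoint Wp Wm ∧
            Disjoint (Set.range Vp) (Set.range Vm) ∧
            (∀ i, G.degree (Vp i) ≤ d - 1) ∧ (∀ i, G.degree (Vm i) ≤ d - 1) ∧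
            SlyPropA G lam Wp Wm n ∧
            SlyPropB G lam Wp Wm Vp Vm qp qm ((n : ℝ) ^ (-(2 * θ))) := by
  sorry

/-- S1 is exactly what the named fact `slyGadgetReduction` provides (sanity link, PROVED). -/
example (h : slyGadgetReduction) : ∀ Δ : ℕ, 3 ≤ Δ → ∀ lam : ℝ, hardCoreThreshold Δ < lam →
    ∃ d : ℕ, 3 ≤ d ∧ d ≤ Δ ∧ hardCoreThreshold d < lam ∧
    ∃ θ qp qm : ℝ, 0 < θ ∧ θ < 1 / 8 ∧ 0 < qm ∧ qm < qp ∧ qp < 1 ∧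
      ∃ n₁ : ℕ, ∀ n : ℕ, n₁ ≤ n →
        ∃ (v : ℕ) (G : SimpleGraph (Fin v)) (Wp Wm : Finset (Fin v))
          (Vp Vm : Fin (slyM d θ n) ↪ Fin v),
          (v : ℝ) ≤ 3 * n ∧ G.maxDegree ≤ d ∧ Disjoint Wp Wm ∧
            Disjoint (Set.range Vp) (Set.range Vm) ∧
            (∀ i, G.degree (Vp i) ≤ d - 1) ∧ (∀ i, G.degree (Vm i) ≤ d - 1) ∧
            SlyPropA G lam Wp Wm n ∧
            SlyPropB G lam Wp Wm Vp Vm qp qm ((n : ℝ) ^ (-(2 * θ))) := by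
  intro Δ hΔ lam hlam
  obtain ⟨d, hd3, hdΔ, hdlam, θ, qp, qm, hθ, hθ8, hqm, hlt, hqp, hmain⟩ := h Δ hΔ lam hlam
  obtain ⟨n₁, hn₁⟩ := hmain (1 / 2) (by norm_num)
  refine ⟨d, hd3, hdΔ, hdlam, θ, qp, qm, hθ, hθ8, hqm, hlt, hqp, n₁, fun n hn => ?_⟩
  obtain ⟨v, G, Wp, Wm, Vp, Vm, hv, hdeg, hW, hVV, hdp, hdm, hA, hB, -⟩ := hn₁ n hn
  exact ⟨v, G, Wp, Wm, Vp, Vm, hv, hdeg, hW, hVV, hdp, hdm, hA, hB⟩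

/-- **S2 — the source: bounded-occurrence, boundary-expanding, far 3-XOR templates for EVERY radius** (all
ingredients PROVED in the tree). For some `D` and every `s₀` there is a template on `n ≤ m` variables and `m > 0`
equations with three distinct variables each, occurrence indices making `(var, idx)` injective, `(s₀, 1/2)`-boundary
expansion, and a right-hand side `b` that every assignment violates on `e ≥ m/16` equations. Why true (size M):
`Xor3Gap.exists_threeUniformExpander` (`n₀ = 192τ`, `m = 768τ`, `c = 4`, `τ ≥ s₀·1728⁴`) gives `7|T| ≤ 4|N(T)|` for
`|T| ≤ s₀`; `SparseOrData.splitScope … 48` keeps scopes of size 3, gives occurrence `≤ 48` (`splitDeg_le`), at least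
the same vertex expansion (`card_biUnion_le_card_biUnion_split`) and `≤ n₀ + 3m/48 = 240τ ≤ m` variables
(`card_splitVar_le`); `Xor3Gap.card_le_two_mul_card_boundary` turns it into `|T| ≤ 2|∂T|`; `SparseOrData.exists_far`
with `SparseOrData.far_ineq` (`p = 2`, `e = 48τ + 1`) gives the far right-hand side; order each scope
(`Finset.card_eq_three`), transport `SplitVar ≃ Fin n` (`Fintype.equivFin`), and take `idx u p := rank` of `u` among
the scopes containing `var u p` (`SparseOrData.rank`, `< deg ≤ 48`, injective by `rank_injOn`). -/
theorem stub_source : ∃ D : ℕ, 0 < D ∧ ∀ s₀ : ℕ,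
    ∃ (n m : ℕ) (T : Template n m D) (b : Fin m → ZMod 2) (e : ℕ),
      0 < m ∧ n ≤ m ∧ m ≤ 16 * e ∧ T.InjIdx ∧ T.WellFormed ∧ T.Expands s₀ ∧ T.Far b e := by
  sorry

/-- **S3 — degree bound.** If the gadget has maximum degree `≤ d ≤ Δ` (`Δ ≥ 3`), disjoint `V⁺`/`V⁻` port ranges and
port degrees `≤ d - 1`, then the wired graph has maximum degree `≤ Δ`: a `V⁺` port in clique slot `(p, j)` meets ONE
port edge (the unique local assignment agreeing with it exactly at `p`), a `V⁺` port in connector slot `(p, i*, j)`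
meets at most ONE connector leaf (`ℓ₀` of `(var u p, idx u p, i*, val_p, j)` if `idx u p < i*`, `ℓ₁` of
`(var u p, i*, idx u p, val_p − 1, j)` if `i* < idx u p`, none if equal), a `V⁻` port in slot `j` meets at most one
pendant leaf; leaves have degree `≤ 1`; a connector leaf `ℓ₀`/`ℓ₁` is adjacent to its partner and to the ports of the
(exactly two, by `InjIdx`) vertices of its side: degree `3 ≤ Δ`. Why true: case analysis on `wRel` exactly as
`maxDegree_gadgetSubst_le` (HardcoreInapproximability.lean). Size S–M. -/
theorem stub_maxDegree {Δ d : ℕ} (T : Template n m D) (hT : T.InjIdx) (W : Wiring v mP s r tL D)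
    (tU : Fin m → ℕ) (b : Fin m → ZMod 2) (hΔ : 3 ≤ Δ) (hd : d ≤ Δ) (hG : W.G.maxDegree ≤ d)
    (hVV : Disjoint (Set.range W.Vp) (Set.range W.Vm))
    (hdp : ∀ i, W.G.degree (W.Vp i) ≤ d - 1) (hdm : ∀ i, W.G.degree (W.Vm i) ≤ d - 1) :
    (wGraph T W tU b).maxDegree ≤ Δ := by
  sorry

/-- **S4 — Duplicator (gauge flips + local consistency; an instance of the PROVED transfer theorem
`ckEquiv_of_consistencyFamily`, Atserias–Dawar 2019 Lemma 3.2 / Cai–Fürer–Immerman §6).** On an `(s₀, 1/2)`-boundary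
expander with three distinct variables per equation, the wired graphs of ANY right-hand side `b` and of `0` are
`≡_{C^k}` for `12k ≤ s₀` (`k ≥ 1`). Why true: the flip by `f : Fin n → ZMod 2`,
`((u,t₁,t₂), a) ↦ ((u, t₁ + f(var u 0), t₂ + f(var u 1)), a)`, same on leaves, `(x,i,i',c,j,e) ↦ (x,i,i',c + f x,j,e)`,
is a local flip action (`IsLocalFlipAction`) for the data `D(copy/leaf of u) = T.scope u`, `D(connector) = {x}`,
`c₀ = 3`; every clause of `wRel` is flip-invariant except the connector attachments, where `val b' (flipped) p =
val b w p + f (var u p)` holds at `p = 0, 1` identically and at `p = 2` iff `f(var u 0)+f(var u 1)+f(var u 2) = b u`,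
which is `XorSystem.Good.sum_scope_eq` (scope `⊆ dom`, `1 ≤ s₀`, `WellFormed` makes the scope sum the three-term
sum) — the `hcompat` clause; `isConsistencyFamily_good` (`q = 1`, `p = 2`, `K = 3k`, `4K ≤ s₀`) supplies the
consistency family. Size M. -/
theorem stub_duplicator (T : Template n m D) (hwf : T.WellFormed) (W : Wiring v mP s r tL D) (tU : Fin m → ℕ)
    (b : Fin m → ZMod 2) {s₀ k : ℕ} (hk : 1 ≤ k) (hexp : T.Expands s₀) (hks : 12 * k ≤ s₀) :
    CkEquiv k (wGraph T W tU b) (wGraph T W tU 0) := by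
  sorry

/-- **S5 — Sly's Lemma 2.2 for the slot wiring (the transducer; HARDEST provable-now stub).** For ANY gadget with
`(GpropA)` at `n₁` and `(GpropB)` with error `δ ∈ [0, 1]`, any template with `InjIdx`, leaf counts `tU ≤ tL` and any
phase vector `Y`: `(phaseProbs)` `Z_base(Y) ≥ Z_base/n₁^{4m}` and `(cutProb)`
`(1−δ)^{4m}·wW_b(Y)·Z_base(Y) ≤ Z_{wGraph b}(Y) ≤ (1+δ)^{4m}·wW_b(Y)·Z_base(Y)` — for EVERY `m` (no `o(1)`: this is
the density-scale accounting). Why true: as `cutProb_bounds_of_slyPropB` / `phaseProbs_of_slyPropA` (PROVED for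
`gadgetSubst`): on `wBase` the copies are independent and the extras contribute `(1+λ)` per leaf and `(1+2λ)` per
connector pair; given the port patterns of all copies, the clique port edges are indicator products and each leaf /
connector a multilinear polynomial in the vacancy indicators of DISTINCT ports (slots injective, `V⁺`/`V⁻` ranges
disjoint, `InjIdx`), so under the product measure the conditional expectation is exactly `wW_b(Y)` times the base
value, and `(GpropB)` (`SlyPropB.restrict` for unused ports, `sum_patterns_portLaw`-style bookkeeping) costs one factor
`(1 ± δ)` per copy. Size L (adapt `hardcoreZOn_gadgetSubst_phaseVec_eq_sum`, `sum_patterns_portLaw`,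
`cutProb_bounds_of_slyPropB`, `phaseProbs_of_slyPropA`). -/
theorem stub_transducer (T : Template n m D) (hT : T.InjIdx) (W : Wiring v mP s r tL D)
    (hVV : Disjoint (Set.range W.Vp) (Set.range W.Vm)) (tU : Fin m → ℕ) (htU : ∀ u, tU u ≤ tL)
    {lam : ℝ} (hlam : 0 ≤ lam) {qp qm δ : ℝ} (hqm : 0 < qm) (hlt : qm < qp) (hqp : qp < 1)
    (hδ0 : 0 ≤ δ) (hδ1 : δ ≤ 1) {n₁ : ℕ} (hn₁ : 0 < n₁) (hA : SlyPropA W.G lam W.Wp W.Wm n₁)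
    (hB : SlyPropB W.G lam W.Wp W.Wm W.Vp W.Vm qp qm δ) (b : Fin m → ZMod 2) (Y : BV m → Bool) :
    independencePolynomial (wBase n m W) lam / (n₁ : ℝ) ^ Fintype.card (BV m) ≤
        hardcoreZOn (wBase n m W) lam (fun I => wPhase W I = Y) ∧
      (1 - δ) ^ Fintype.card (BV m) *
          (wW T b lam qp qm s r tU Y * hardcoreZOn (wBase n m W) lam (fun I => wPhase W I = Y)) ≤
        hardcoreZOn (wGraph T W tU b) lam (fun I => wPhase W I = Y) ∧
      hardcoreZOn (wGraph T W tU b) lam (fun I => wPhase W I = Y) ≤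
        (1 + δ) ^ Fintype.card (BV m) *
          (wW T b lam qp qm s r tU Y * hardcoreZOn (wBase n m W) lam (fun I => wPhase W I = Y)) := by
  sorry

/-- **S6 — the lattice-gas energy gap (the new finite content of the line; triage sharpening: first stub).**
For a template with `InjIdx` and three distinct variables per equation, an `e`-far right-hand side `b`, and
parameters in the WINDOW — fields `φ_u = tU u·ψ₁ − 3s·h_P − cK u·r·h_K ∈ [μ, μ + ψ₁]` (`μ := t₀ψ₁ − 3s h_P ≥ 0`,
leaf compensation `htU`), clique repulsion `s·log slyB ≥ (μ + ψ₁) + D·r·a_K`, connector repulsion `r·u_K ≥ μ + ψ₁` —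
the planted phase vector `Y₀ = 𝟙{t = 0}` of the `b = 0` twin beats EVERY phase vector of the `b`-twin by `e^{μ e}`:
`wW_b(Y)·e^{μ e} ≤ wW_0(Y₀)`. Why true (charging argument): with `T = Y⁻¹(+)`,
`log wW_b(Y) − log wW(∅) = Σ_{v∈T} φ_v − s·log slyB·e_P(T) + Σ_κ R_κ`, where per clique `u` with `j` vertices in `T`
the bundles give `−3j s h_P − C(j,2) s log slyB` (`pair₊₋²/(pair₊₊pair₋₋) = slyB`), and the connector remainder
satisfies `R(i,j) ≤ a_K([i=2]+[j=2]) − u_K[i≥1][j≥1]` for `(i,j) =` numbers of `+` on the two sides (equalities at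
`(2,0),(1,1)` by definition; `(2,1),(2,2)` by concavity of `F(S) = log(1+λS)` and majorisation:
`F(X₂+X₁)+F(X₁+X₀) ≤ F(X₂+X₀)+F(2X₁)`, `F(2X₂)+2F(X₁+X₀) ≤ 2F(X₂+X₀)+F(2X₁)`); a side lying in `T` is a clique edge in
`T` and is a side of `≤ D` connectors, so `log wW_b(Y) − log wW(∅) ≤ Σ_{T} φ_v − (s log slyB − D r a_K)·e_P(T) −
r u_K·viol(T)`; deleting one `+` vertex from a violated clique edge / connector changes this bound by `≥ U' − φ_v ≥ 0`,
so it is `≤ Σ_{T'} φ_v` for a violation-free `T' ⊆ T`, i.e. an FGLSS-independent set = a consistent partial assignment,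
which extends to a total `g` with `T' ⊆ {(u, g|_u) : u satisfied}`: `≤ Σ_{u sat g} φ_u`. On the `b = 0` twin the
planted `Y₀` has no violation and no side inside it and collects `Σ_u φ_u` EXACTLY (each connector has exactly one
active side with one `+`: factor `e^{−h_K}`; 3 clique edges per `+` vertex: `e^{−3 s h_P}`; leaves `e^{tU ψ₁}`), and
`wW_b(∅) = wW_0(∅)` (all-`−`: every side has exactly two vertices by `InjIdx`). Hence the gap is
`≥ Σ_{u unsat g} φ_u ≥ e·μ`. Size M–L (finite sums/products, `Real.log` concavity). -/
theorem stub_latticeGasGap (T : Template n m D) (hT : T.InjIdx) (hwf : T.WellFormed)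
    {lam qp qm : ℝ} (hlam : 0 < lam) (hqm : 0 < qm) (hlt : qm < qp) (hqp : qp < 1)
    (b : Fin m → ZMod 2) {e : ℕ} (hfar : T.Far b e) {s r t₀ : ℕ} {tU : Fin m → ℕ}
    (htU : ∀ u, t₀ * psi1 lam qp qm + T.cK u * r * hK lam qp qm ≤ tU u * psi1 lam qp qm ∧
      tU u * psi1 lam qp qm ≤ t₀ * psi1 lam qp qm + T.cK u * r * hK lam qp qm + psi1 lam qp qm)
    (hW0 : 0 ≤ t₀ * psi1 lam qp qm - 3 * s * hP qp qm)
    (hW2 : t₀ * psi1 lam qp qm + psi1 lam qp qm - 3 * s * hP qp qm + D * r * aK lam qp qm ≤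
      s * Real.log (slyB qp qm))
    (hW3 : t₀ * psi1 lam qp qm + psi1 lam qp qm - 3 * s * hP qp qm ≤ r * uK lam qp qm) :
    ∃ Y₀ : BV m → Bool, ∀ Y : BV m → Bool,
      wW T b lam qp qm s r tU Y * Real.exp ((t₀ * psi1 lam qp qm - 3 * s * hP qp qm) * e) ≤
        wW T 0 lam qp qm s r tU Y₀ := by
  sorry

/-- **S7 — the window and the budget are satisfiable (asymptotic arithmetic, incl. positivity of the lattice-gas
constants).** For `0 < q⁻ < q⁺ < 1`, `λ > 0`, `θ > 0`, `d ≥ 3` and any `D`, `N_A`: `ψ₁ > 0`, `h_K > 0`, and there are a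
gadget size `n₁ ≥ N_A` (`δ₁ = n₁^{-2θ} ≤ 1`), slot numbers `s, r`, leaf numbers `t₀ ≤ tL` and `δ > 0` with: the port
budget `3s + 3Dr ≤ slyM d θ n₁`, `tL ≤ slyM d θ n₁`, `t₀ + 3Dr h_K/ψ₁ + 1 ≤ tL`; the window
`0 ≤ μ := t₀ψ₁ − 3s h_P`, `μ + ψ₁ + D r a_K ≤ s log slyB`, `μ + ψ₁ ≤ r u_K`; and the BUDGET: for all `m > 0`, `e` with
`m ≤ 16e` and `N_tot ≤ m(12n₁ + 4tL + 4D²r)`, `e^{δ N_tot}·((1+δ₁)n₁)^{4m} ≤ (1−δ₁)^{4m}·e^{μ e}`. Why true: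
`ψ₁, h_P, log slyB, h_K > 0` directly from `q⁻ < q⁺` (`one_lt_slyB`); `u_K > 0` by AM–GM
(`(1+λ(X₁+X₀))² − (1+2λX₁)(1+2λX₀) = λ²(X₀−X₁)²`); `a_K > 0` since
`(1+λ(X₂+X₀))(1+2λX₀) − (1+λ(X₁+X₀))² = λ(1+λX₀)(q⁺−q⁻)²`; then with `M := 64 log(3n₁) + 16`:
`r = ⌈(M+2ψ₁)/u_K⌉`, `s = ⌈(M+2ψ₁+D r a_K)/log slyB⌉`, `t₀ = ⌈(M+3s h_P)/ψ₁⌉` (so `μ ∈ [M, M+ψ₁)`),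
`tL = t₀ + ⌈3Dr h_K/ψ₁⌉ + 2`, all `O(log n₁) ≤ slyM d θ n₁ ≥ n₁^{3θ/4} − 1` for `n₁` large (`mul_slyK_le_slyM`),
`δ₁ ≤ 1/2`, and `δ := 1/(12n₁ + 4tL + 4D²r)`: `δ N_tot + 4m log((1+δ₁)n₁/(1−δ₁)) ≤ m + 4m log(3n₁) ≤ μ m/16 ≤ μ e`.
Size M (rpow/log/ceil manipulation in the style of `eventually_mul_rpow_rpow_le_slyB_pow`). -/
theorem stub_parameters {lam qp qm θ : ℝ} (hlam : 0 < lam) (hqm : 0 < qm) (hlt : qm < qp) (hqp : qp < 1)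
    (hθ : 0 < θ) {d : ℕ} (hd : 3 ≤ d) (D N_A : ℕ) :
    0 < psi1 lam qp qm ∧ 0 < hK lam qp qm ∧
    ∃ n₁ : ℕ, N_A ≤ n₁ ∧ 0 < n₁ ∧ (n₁ : ℝ) ^ (-(2 * θ)) ≤ 1 ∧
    ∃ (s r t₀ tL : ℕ) (δ : ℝ), 0 < δ ∧ 0 < tL ∧
      Fintype.card ((Fin 3 × Fin s) ⊕ (Fin 3 × Fin D × Fin r)) ≤ slyM d θ n₁ ∧ tL ≤ slyM d θ n₁ ∧
      (t₀ : ℝ) + 3 * D * r * hK lam qp qm / psi1 lam qp qm + 1 ≤ tL ∧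
      0 ≤ t₀ * psi1 lam qp qm - 3 * s * hP qp qm ∧
      t₀ * psi1 lam qp qm + psi1 lam qp qm - 3 * s * hP qp qm + D * r * aK lam qp qm ≤
        s * Real.log (slyB qp qm) ∧
      t₀ * psi1 lam qp qm + psi1 lam qp qm - 3 * s * hP qp qm ≤ r * uK lam qp qm ∧
      ∀ m e Ntot : ℕ, 0 < m → m ≤ 16 * e → (Ntot : ℝ) ≤ m * (12 * n₁ + 4 * tL + 4 * D ^ 2 * r) →
        Real.exp (δ * Ntot) * ((1 + (n₁ : ℝ) ^ (-(2 * θ))) * n₁) ^ (4 * m) ≤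
          (1 - (n₁ : ℝ) ^ (-(2 * θ))) ^ (4 * m) *
            Real.exp ((t₀ * psi1 lam qp qm - 3 * s * hP qp qm) * e) := by
  sorry

/-! ## Proved glue -/

/-- `q± ∈ [0,1]` bookkeeping for the port probabilities. -/
theorem pP_mem {qp qm : ℝ} (hqm0 : 0 ≤ qm) (hqm1 : qm ≤ 1) (hqp0 : 0 ≤ qp) (hqp1 : qp ≤ 1) (s : Bool) :
    0 ≤ pP qp qm s ∧ pP qp qm s ≤ 1 ∧ 0 ≤ pM qp qm s ∧ pM qp qm s ≤ 1 := by
  cases s <;> simp [pP, pM] <;> refine ⟨?_, ?_, ?_, ?_⟩ <;> assumption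

/-- The weights are nonnegative (`λ ≥ 0`, `q± ∈ [0, 1]`). -/
theorem wW_nonneg (T : Template n m D) (b : Fin m → ZMod 2) {lam qp qm : ℝ} (hlam : 0 ≤ lam) (hqm0 : 0 ≤ qm)
    (hqm1 : qm ≤ 1) (hqp0 : 0 ≤ qp) (hqp1 : qp ≤ 1) (s r : ℕ) (tU : Fin m → ℕ) (Y : BV m → Bool) :
    0 ≤ wW T b lam qp qm s r tU Y := by
  have hq := fun s => pP_mem hqm0 hqm1 hqp0 hqp1 s
  have hvac : ∀ x i c, 0 ≤ sideVac T b qp qm Y x i c := fun x i c => by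
    unfold sideVac
    exact Finset.prod_nonneg fun w _ => by linarith [(hq (Y w)).2.1]
  unfold wW
  refine mul_nonneg (mul_nonneg ?_ ?_) ?_
  · unfold pairW
    refine Finset.prod_nonneg fun u _ => Finset.prod_nonneg fun p _ => Finset.prod_nonneg fun c _ =>
      pow_nonneg ?_ _
    obtain ⟨h1, h2, -, -⟩ := hq (Y (u, endpt p c 0))
    obtain ⟨h3, h4, -, -⟩ := hq (Y (u, endpt p c 1))
    nlinarith [mul_le_one₀ h2 h3 h4]
  · unfold leafW
    refine Finset.prod_nonneg fun w _ => pow_nonneg (div_nonneg ?_ (by linarith)) _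
    obtain ⟨-, -, -, h4⟩ := hq (Y w)
    nlinarith
  · unfold connW
    refine Finset.prod_nonneg fun x _ => Finset.prod_nonneg fun i _ => Finset.prod_nonneg fun i' _ =>
      Finset.prod_nonneg fun c _ => pow_nonneg ?_ _
    split_ifs
    · refine div_nonneg ?_ (by linarith)
      have h1 := hvac x i c
      have h2 := hvac x i' (c + 1)
      nlinarith [mul_nonneg hlam h1, mul_nonneg hlam h2]
    · exact zero_le_one

/-- **Sly's proof of Theorem 1 at density scale, run for the two twins** (PROVED): from the upper `(cutProb)` bound
with factor `B` for every phase vector of the far twin, the lower bound with factor `A` and `(phaseProbs)` with factor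
`C` at the planted vector `Y₀`, the energy gap `W₁ Y · E ≤ W₀ Y₀`, and the budget `R·B·C ≤ A·E`:
`R · Z(X₁) ≤ Z(X₀)`. -/
theorem twins_of_estimates {α β : Type*} [Fintype α] [DecidableEq α] [Fintype β]
    (X₀ X₁ Xb : SimpleGraph α) (ph : Finset α → β) {lam : ℝ} (hlam : 0 ≤ lam)
    (W₀ W₁ : β → ℝ) (hW₁ : ∀ Y, 0 ≤ W₁ Y) {A B C E R : ℝ} (hA : 0 ≤ A) (hB : 0 ≤ B) (hC : 0 < C)
    (hE : 0 < E) (hR : 0 ≤ R) (Y₀ : β)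
    (hup : ∀ Y, hardcoreZOn X₁ lam (fun I => ph I = Y) ≤ B * (W₁ Y * hardcoreZOn Xb lam (fun I => ph I = Y)))
    (hlo : A * (W₀ Y₀ * hardcoreZOn Xb lam (fun I => ph I = Y₀)) ≤ hardcoreZOn X₀ lam (fun I => ph I = Y₀))
    (hph : independencePolynomial Xb lam / C ≤ hardcoreZOn Xb lam (fun I => ph I = Y₀))
    (hgap : ∀ Y, W₁ Y * E ≤ W₀ Y₀) (hbudget : R * (B * C) ≤ A * E) :
    R * independencePolynomial X₁ lam ≤ independencePolynomial X₀ lam := by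
  set Zb : β → ℝ := fun Y => hardcoreZOn Xb lam (fun I => ph I = Y) with hZb
  set Zbase : ℝ := independencePolynomial Xb lam with hZbase
  have hZb0 : ∀ Y, 0 ≤ Zb Y := fun Y => hardcoreZOn_nonneg _ hlam _
  have hZbase0 : 0 ≤ Zbase := (independencePolynomial_pos _ hlam).le
  have hW00 : 0 ≤ W₀ Y₀ := by
    have := hgap Y₀
    nlinarith [hW₁ Y₀, mul_nonneg (hW₁ Y₀) hE.le]
  -- upper bound for the far twin
  have hup' : independencePolynomial X₁ lam ≤ B * (W₀ Y₀ / E) * Zbase := by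
    rw [hZbase, ← sum_hardcoreZOn_fiber X₁ lam ph, ← sum_hardcoreZOn_fiber Xb lam ph, Finset.mul_sum]
    refine Finset.sum_le_sum fun Y _ => ?_
    have h2 : W₁ Y ≤ W₀ Y₀ / E := by
      rw [le_div_iff₀ hE]; exact hgap Y
    calc hardcoreZOn X₁ lam (fun I => ph I = Y) ≤ B * (W₁ Y * Zb Y) := hup Y
      _ ≤ B * (W₀ Y₀ / E * Zb Y) := by
          have := mul_le_mul_of_nonneg_right h2 (hZb0 Y)
          exact mul_le_mul_of_nonneg_left this hB
      _ = B * (W₀ Y₀ / E) * Zb Y := by ring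
  -- lower bound for the planted twin
  have hlo' : A * W₀ Y₀ * (Zbase / C) ≤ independencePolynomial X₀ lam := by
    have hA' : A * W₀ Y₀ * (Zbase / C) ≤ A * (W₀ Y₀ * Zb Y₀) := by
      have := mul_le_mul_of_nonneg_left hph (mul_nonneg hA hW00)
      calc A * W₀ Y₀ * (Zbase / C) ≤ A * W₀ Y₀ * Zb Y₀ := this
        _ = A * (W₀ Y₀ * Zb Y₀) := by ring
    calc A * W₀ Y₀ * (Zbase / C) ≤ A * (W₀ Y₀ * Zb Y₀) := hA'
      _ ≤ hardcoreZOn X₀ lam (fun I => ph I = Y₀) := hlo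
      _ ≤ independencePolynomial X₀ lam := hardcoreZOn_le_independencePolynomial _ hlam _
  -- combine with the budget
  have hX : 0 ≤ W₀ Y₀ * Zbase := mul_nonneg hW00 hZbase0
  calc R * independencePolynomial X₁ lam ≤ R * (B * (W₀ Y₀ / E) * Zbase) :=
        mul_le_mul_of_nonneg_left hup' hR
    _ = R * (B * C) * (W₀ Y₀ * Zbase) / (E * C) := by
        field_simp
    _ ≤ A * E * (W₀ Y₀ * Zbase) / (E * C) := by
        have := mul_le_mul_of_nonneg_right hbudget hX
        exact div_le_div_of_nonneg_right this (by positivity)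
    _ = A * W₀ Y₀ * (Zbase / C) := by
        field_simp
    _ ≤ independencePolynomial X₀ lam := hlo'

/-- The independence polynomial is invariant under transport along a bijection of the vertices. -/
theorem independencePolynomial_map_equiv {α β : Type*} [Fintype α] [DecidableEq α] [Fintype β]
    [DecidableEq β] (G : SimpleGraph α) (e : α ≃ β) (lam : ℝ) :
    independencePolynomial (G.map e.toEmbedding) lam = independencePolynomial G lam := by
  have hadj : ∀ a b : α, (G.map e.toEmbedding).Adj (e.toEmbedding a) (e.toEmbedding b) ↔ G.Adj a b :=
    fun a b => SimpleGraph.map_adj_apply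
  have hind : ∀ I : Finset α,
      (G.map e.toEmbedding).IsIndepSet (↑(I.map e.toEmbedding) : Set β) ↔ G.IsIndepSet (↑I : Set α) := by
    intro I
    constructor
    · intro h a ha b hb hab
      have hab' : e.toEmbedding a ≠ e.toEmbedding b := fun h' => hab (e.injective h')
      have := h (Finset.mem_coe.2 (Finset.mem_map_of_mem _ (Finset.mem_coe.1 ha)))
        (Finset.mem_coe.2 (Finset.mem_map_of_mem _ (Finset.mem_coe.1 hb))) hab'
      exact fun hG => this ((hadj a b).2 hG)
    · intro h x hx y hy hxy
      obtain ⟨a, ha, rfl⟩ := Finset.mem_map.1 (Finset.mem_coe.1 hx)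
      obtain ⟨b, hb, rfl⟩ := Finset.mem_map.1 (Finset.mem_coe.1 hy)
      exact fun hG => h (Finset.mem_coe.2 ha) (Finset.mem_coe.2 hb) (fun hab => hxy (by rw [hab]))
        ((hadj a b).1 hG)
  unfold independencePolynomial
  symm
  refine Fintype.sum_equiv (Equiv.finsetCongr e) _ _ fun I => ?_
  rw [Equiv.finsetCongr_apply, Finset.card_map]
  by_cases hI : G.IsIndepSet (↑I : Set α)
  · rw [if_pos hI, if_pos ((hind I).2 hI)]
  · rw [if_neg hI, if_neg (fun h => hI ((hind I).1 h))]

/-- Transport of a degree bound along an isomorphism, for ANY decidability instances. -/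
theorem maxDegree_le_of_iso {α β : Type*} [Fintype α] [Fintype β] {G : SimpleGraph α} {H : SimpleGraph β}
    {iG : DecidableRel G.Adj} {iH : DecidableRel H.Adj} (f : G ≃g H) {Δ : ℕ}
    (h : @SimpleGraph.maxDegree α G _ iG ≤ Δ) : @SimpleGraph.maxDegree β H _ iH ≤ Δ := by
  have := f.maxDegree_eq
  rw [← this]; exact h

/-- The route's inlined sum IS `independencePolynomial`, for ANY decidability instances. -/
theorem indepSum_eq {α : Type*} [Fintype α] [DecidableEq α] (G : SimpleGraph α) {iG : DecidableRel G.Adj}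
    {dI : ∀ I : Finset α, Decidable (G.IsIndepSet (↑I : Set α))} (lam : ℝ) :
    (∑ I : Finset α, @ite ℝ (G.IsIndepSet (↑I : Set α)) (dI I) (lam ^ I.card) 0) =
      @independencePolynomial α _ _ G iG ℝ _ lam := by
  unfold independencePolynomial
  exact Finset.sum_congr rfl fun I _ => by congr

/-- The number of FGLSS vertices. -/
theorem card_BV (m : ℕ) : Fintype.card (BV m) = 4 * m := by
  simp only [BV, Fintype.card_prod, Fintype.card_fin, ZMod.card]
  ring

/-- The number of vertices of the wired graph. -/
theorem card_WV (n m v tL D r : ℕ) :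
    Fintype.card (WV n m v tL D r) = 4 * m * v + 4 * m * tL + n * D * D * 2 * r * 2 := by
  simp only [WV, CV, BV, Fintype.card_sum, Fintype.card_prod, Fintype.card_fin, ZMod.card]
  ring

/-! ## The composition (kernel-checked, no `sorry` of its own) -/

/-- **`MacroscopicTwinsAbove` from the seven stubs.** Given `Δ ≥ 3`, `λ > λ_c(Δ)`: S1 gives `d, θ, q±` and gadgets
for all large sizes; S7 fixes ONE size `n₁` and `s, r, t₀, tL, δ` (all from `(Δ, λ)` alone) — so `δ` is uniform in
`k`; for each `k`, S2 supplies a far, expanding, bounded-occurrence template at radius `12(k+1)`; the twins are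
`wGraph T W tU 0` (planted) and `wGraph T W tU b` (far) transported to `Fin N`: degree by S3, `≡_{C^{k+1}}` by S4
(`CkEquiv.iso_congr`) turned into the hom-count clause by the PROVED Dvořák bridge, and the `e^{δN}` gap by
S5 (both twins) + S6 + the budget of S7 through `twins_of_estimates`. -/
theorem MacroscopicTwinsAbove_of : MacroscopicTwinsAbove := by
  intro Δ hΔ lam hlam
  have hlam' : hardCoreThreshold Δ < lam := hlam
  obtain ⟨d, hd3, hdΔ, hdlam, θ, qp, qm, hθ, hθ8, hqm, hlt, hqp, nA, hnA⟩ := stub_slyGadgets Δ hΔ lam hlam'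
  have hlam0 : 0 < lam := (hardCoreThreshold_pos hd3).trans hdlam
  obtain ⟨D, hD, hsrc⟩ := stub_source
  obtain ⟨hψ, hhK, n₁, hn₁A, hn₁, hδ₁1, s, r, t₀, tL, δ, hδ, htL, hport, hportL, htLge, hW0, hW2, hW3, hbudget⟩ :=
    stub_parameters hlam0 hqm hlt hqp hθ hd3 D nA
  refine ⟨δ, hδ, fun k => ?_⟩
  -- the template at radius `12 (k + 1)`
  obtain ⟨n, m, T, b, e, h0m, hnm, hme, hinj, hwf, hexp, hfar⟩ := hsrc (12 * (k + 1))
  -- the gadget at size `n₁`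
  obtain ⟨v, G, Wp, Wm, Vp, Vm, hv, hdeg, -, hVV, hdp, hdm, hA, hB⟩ := hnA n₁ hn₁A
  set δ₁ : ℝ := (n₁ : ℝ) ^ (-(2 * θ)) with hδ₁def
  have hδ₁0 : 0 ≤ δ₁ := Real.rpow_nonneg (Nat.cast_nonneg n₁) _
  -- leaf counts (compensation of the connector fields)
  set ρ : ℝ := r * hK lam qp qm / psi1 lam qp qm with hρ
  have hρ0 : 0 ≤ ρ := div_nonneg (mul_nonneg r.cast_nonneg hhK.le) hψ.le
  let tU : Fin m → ℕ := fun u => t₀ + ⌈(T.cK u : ℝ) * ρ⌉₊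
  have htU : ∀ u, t₀ * psi1 lam qp qm + T.cK u * r * hK lam qp qm ≤ tU u * psi1 lam qp qm ∧
      tU u * psi1 lam qp qm ≤ t₀ * psi1 lam qp qm + T.cK u * r * hK lam qp qm + psi1 lam qp qm := by
    intro u
    have hx0 : 0 ≤ (T.cK u : ℝ) * ρ := mul_nonneg (Nat.cast_nonneg _) hρ0
    have hxψ : (T.cK u : ℝ) * ρ * psi1 lam qp qm = T.cK u * r * hK lam qp qm := by
      rw [hρ]; field_simp
    have hcast : ((tU u : ℕ) : ℝ) = t₀ + (⌈(T.cK u : ℝ) * ρ⌉₊ : ℝ) := by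
      simp [tU]
    constructor
    · have h1 : (T.cK u : ℝ) * ρ ≤ ⌈(T.cK u : ℝ) * ρ⌉₊ := Nat.le_ceil _
      rw [hcast, add_mul, ← hxψ]
      nlinarith [mul_le_mul_of_nonneg_right h1 hψ.le]
    · have h1 : (⌈(T.cK u : ℝ) * ρ⌉₊ : ℝ) < (T.cK u : ℝ) * ρ + 1 := Nat.ceil_lt_add_one hx0
      rw [hcast, add_mul, ← hxψ]
      nlinarith [mul_le_mul_of_nonneg_right h1.le hψ.le]
  have htUle : ∀ u, tU u ≤ tL := by
    intro u
    have hx0 : 0 ≤ (T.cK u : ℝ) * ρ := mul_nonneg (Nat.cast_nonneg _) hρ0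
    have h1 : (⌈(T.cK u : ℝ) * ρ⌉₊ : ℝ) < (T.cK u : ℝ) * ρ + 1 := Nat.ceil_lt_add_one hx0
    have h2 : (T.cK u : ℝ) ≤ 3 * D := by exact_mod_cast T.cK_le u
    have h3 : (T.cK u : ℝ) * ρ ≤ 3 * D * r * hK lam qp qm / psi1 lam qp qm := by
      rw [hρ, ← mul_div_assoc]
      refine div_le_div_of_nonneg_right ?_ hψ.le
      have := mul_le_mul_of_nonneg_right h2 (mul_nonneg r.cast_nonneg hhK.le)
      linarith [this]
    have h4 : ((tU u : ℕ) : ℝ) ≤ tL := by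
      have hcast : ((tU u : ℕ) : ℝ) = t₀ + (⌈(T.cK u : ℝ) * ρ⌉₊ : ℝ) := by simp [tU]
      rw [hcast]; linarith
    exact_mod_cast h4
  -- the wiring and the two graphs
  let W : Wiring v (slyM d θ n₁) s r tL D := ⟨G, Wp, Wm, Vp, Vm, slotEmb hport, Fin.castLEEmb hportL⟩
  let X₀ : SimpleGraph (WV n m v tL D r) := wGraph T W tU 0
  let X₁ : SimpleGraph (WV n m v tL D r) := wGraph T W tU b
  obtain ⟨N, hN⟩ : ∃ N : ℕ, Fintype.card (WV n m v tL D r) = N := ⟨_, rfl⟩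
  have hNcard : N = 4 * m * v + 4 * m * tL + n * D * D * 2 * r * 2 := by rw [← hN, card_WV]
  let eN : WV n m v tL D r ≃ Fin N := Fintype.equivFinOfCardEq hN
  -- degrees (S3)
  have hdegX₀ : X₀.maxDegree ≤ Δ := stub_maxDegree T hinj W tU 0 hΔ hdΔ hdeg hVV hdp hdm
  have hdegX₁ : X₁.maxDegree ≤ Δ := stub_maxDegree T hinj W tU b hΔ hdΔ hdeg hVV hdp hdm
  -- Duplicator (S4) at level `k + 1`
  have hck : CkEquiv (k + 1) X₁ X₀ :=
    stub_duplicator T hwf W tU b (Nat.succ_pos k) hexp le_rfl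
  -- the estimates (S5) and the energy gap (S6)
  obtain ⟨Y₀, hgap⟩ := stub_latticeGasGap T hinj hwf hlam0 hqm hlt hqp b hfar (s := s) (r := r) htU hW0 hW2 hW3
  have hS5₀ := stub_transducer T hinj W hVV tU htUle hlam0.le hqm hlt hqp hδ₁0 hδ₁1 hn₁ hA hB 0 Y₀
  have hS5₁ := fun Y => (stub_transducer T hinj W hVV tU htUle hlam0.le hqm hlt hqp hδ₁0 hδ₁1 hn₁ hA hB b Y).2.2
  -- the budget at this instance
  have hNtot : (N : ℝ) ≤ m * (12 * n₁ + 4 * tL + 4 * D ^ 2 * r) := by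
    have hn' : (n : ℝ) ≤ m := by exact_mod_cast hnm
    have h1 : (4 : ℝ) * m * v ≤ 4 * m * (3 * n₁) := mul_le_mul_of_nonneg_left hv (by positivity)
    have h2 : (n : ℝ) * (D * D * 2 * r * 2) ≤ m * (D * D * 2 * r * 2) :=
      mul_le_mul_of_nonneg_right hn' (by positivity)
    rw [hNcard]
    calc ((4 * m * v + 4 * m * tL + n * D * D * 2 * r * 2 : ℕ) : ℝ)
        = 4 * m * v + 4 * m * tL + n * (D * D * 2 * r * 2) := by push_cast; ring
      _ ≤ 4 * m * (3 * n₁) + 4 * m * tL + m * (D * D * 2 * r * 2) := by linarith [h1, h2]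
      _ = m * (12 * n₁ + 4 * tL + 4 * D ^ 2 * r) := by ring
  have hB' := hbudget m e N h0m hme hNtot
  -- Sly's argument for the two twins
  have htwins : Real.exp (δ * N) * independencePolynomial X₁ lam ≤ independencePolynomial X₀ lam := by
    refine twins_of_estimates X₀ X₁ (wBase n m W) (wPhase W) hlam0.le
      (wW T 0 lam qp qm s r tU) (wW T b lam qp qm s r tU)
      (fun Y => wW_nonneg T b hlam0.le hqm.le (hlt.le.trans hqp.le) (hqm.le.trans hlt.le) hqp.le s r tU Y)
      (B := (1 + δ₁) ^ Fintype.card (BV m)) (A := (1 - δ₁) ^ Fintype.card (BV m))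
      (C := (n₁ : ℝ) ^ Fintype.card (BV m))
      (E := Real.exp ((t₀ * psi1 lam qp qm - 3 * s * hP qp qm) * e))
      (pow_nonneg (by linarith) _) (pow_nonneg (by linarith) _) (pow_pos (by exact_mod_cast hn₁) _)
      (Real.exp_pos _) (Real.exp_pos _).le
      Y₀ hS5₁ hS5₀.2.1 hS5₀.1 hgap ?_
    rw [card_BV, ← mul_pow]
    exact hB'
  refine ⟨N, X₀.map eN.toEmbedding, X₁.map eN.toEmbedding, ?_, ?_, ?_, ?_, ?_⟩
  · -- `0 < N`
    rw [← hN]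
    exact Fintype.card_pos_iff.2 ⟨Sum.inr (Sum.inl (((⟨0, h0m⟩ : Fin m), (0 : ZMod 2), (0 : ZMod 2)), ⟨0, htL⟩))⟩
  · exact maxDegree_le_of_iso (SimpleGraph.Iso.map eN X₀) hdegX₀
  · exact maxDegree_le_of_iso (SimpleGraph.Iso.map eN X₁) hdegX₁
  · -- homomorphism indistinguishability below treewidth `k`
    intro mF F hF
    have hck' : CkEquiv (k + 1) (X₁.map eN.toEmbedding) (X₀.map eN.toEmbedding) :=
      hck.iso_congr (SimpleGraph.Iso.map eN X₁) (SimpleGraph.Iso.map eN X₀)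
    exact (Literature.ModelTheory.FiniteModelTheory.Dvorak2010.homCount_eq_of_ckEquiv (Nat.succ_pos k) hck' F
      (Nat.lt_succ_of_lt hF)).symm
  · -- the macroscopic gap, transported to `Fin N`
    have hZ := htwins
    rw [← independencePolynomial_map_equiv X₀ eN lam, ← independencePolynomial_map_equiv X₁ eN lam] at hZ
    convert hZ using 2 <;> exact indepSum_eq _ _

end Summit.PneNP.PneNP.Cruxes.MacroscopicTwinsAbove.PhaseLatticeGas
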